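import Summits.BirchSwinnertonDyer.BirchSwinnertonDyer.Theorems.EisensteinPrimesFullDescentOrdinaryKernelPow
import HarnessLib

/-!
# Crux `GoodLatticeBDPValue` (stmt-BirchSwinnertonDyer-19032), line `halves`, AN-3 Stub B road — brick F3b:
# Serre's lines at levels `p` and `p²` at a good ORDINARY place above `p`, PACKAGED

Width seat bsd-line-x1-p1-w3 (gen 4). HONEST FRAMING (cell `bsd-eis`, run/shared/lean/pub/bsd-eis/):
TOOL THEOREM ONLY (no `def`, no named fact, no `sorry`); nothing about a summit statement,
Keller–Yin Thm. 2.2.2 or crux 2 is proved here; 0 stubs / cells / labels move.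

WHY (road memo `HOME/line-x1-p1-w3-g4/AN3-StubB-elementary-road.md`, evidence #44, steps A1–A3 at
the prime `3`). The level-`p` statement is the tree's
`exists_line_geomTorsion_of_not_dvd_frobeniusTraceAt` (`OrdinaryReductionTorsionLineProofs`:
`Λ ≤ E[p]` of order `p`, decomposition-stable, inertia trivial on `E[p]/Λ`). The elementary proof of
Theorem T′ needs the SAME kernel-of-reduction line at level `p² = 9` together with its relation to
the level-`p` line: this file packages, from `exists_goodReduction_localModel` +
`goodReduction_reduction_line` + brick F3a (`FullDescentOrdinary.natCard_ker_inf_geomTorsion_pow`,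
p653882), the pair `Λ₁ = ker f ∩ E[p]`, `Λ₂ = ker f ∩ E[p²]`:

* `exists_lines_geomTorsion_sq_of_not_dvd_frobeniusTraceAt` — `#Λ₁ = p`, `#Λ₂ = p²`, `Λ₂` CYCLIC
  (a generator of order `p²`), `Λ₂ ⊓ E[p] = Λ₁`, both stable under the decomposition group
  (`absGaloisRestrict K K_v`), and the inertia group `absInertia K_v` acting trivially on `E[p]/Λ₁`
  and on `E[p²]/Λ₂` (indeed `res τ • x - x ∈ ker f` for every `x`).

References: [SerreInventiones1972] §1.11 Prop. 11 and Cor.; [GreenbergLNM1716] §1 p. 62;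
[SilvermanAEC2009] Prop. VII.2.1, VII.3.1.
-/

noncomputable section

open scoped Classical NNReal NumberField AddSubgroup
open NumberField IsDedekindDomain Polynomial

set_option autoImplicit false
set_option linter.dupNamespace false

namespace Summit.BirchSwinnertonDyer.BirchSwinnertonDyer.Theorems.FullDescentOrdinary

open _root_.WeierstrassCurve Literature.NumberTheory.EllipticCurves Literature.NumberTheory.GaloisRepresentations
  Field IsDedekindDomain.HeightOneSpectrum

/-- **Serre's lines `X_p ≤ E[p]` and `X_{p²} ≤ E[p²]` at a good ordinary place above `p`, packaged.**
For an elliptic curve `E` over a number field `K`, a prime `p` and a place `v ∣ p` of good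
ORDINARY reduction (`p ∤ a_v`): subgroups `Λ₁ ≤ E[p]`, `Λ₂ ≤ E[p²]` of orders `p`, `p²`, `Λ₂` cyclic,
`Λ₂ ∩ E[p] = Λ₁`, both stable under the decomposition group `Γ_{K_v} → Γ_K`, the inertia group
acting trivially on `E[p]/Λ₁` and `E[p²]/Λ₂`. (`Λ_i` = kernel of the reduction map on `E[p^i]`,
Greenberg's `F¹`.) [cite: SerreInventiones1972, §1.11 Prop. 11 and Cor.] [cite: GreenbergLNM1716, §1 p. 62] -/
theorem exists_lines_geomTorsion_sq_of_not_dvd_frobeniusTraceAt {K : Type} [Field K] [NumberField K]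
    (W : WeierstrassCurve K) [W.IsElliptic] (p : ℕ) [hp : Fact p.Prime]
    (v : HeightOneSpectrum (𝓞 K)) (hpv : (p : 𝓞 K) ∈ v.asIdeal) (hgood : W.HasGoodReductionAt v)
    (hord : ¬ ((p : ℤ) ∣ W.frobeniusTraceAt v)) :
    ∃ Λ₁ Λ₂ : AddSubgroup (geomPoints W),
      Λ₁ ≤ geomTorsion W p ∧ Nat.card Λ₁ = p ∧
      Λ₂ ≤ geomTorsion W ((p ^ 2 : ℕ) : ℤ) ∧ Nat.card Λ₂ = p ^ 2 ∧
      Λ₂ ⊓ geomTorsion W p = Λ₁ ∧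
      (∃ x ∈ Λ₂, addOrderOf x = p ^ 2 ∧ ∀ y ∈ Λ₂, ∃ c : ℕ, y = c • x) ∧
      (∀ (τ : absoluteGaloisGroup (v.adicCompletion K)), ∀ x ∈ Λ₁,
        absGaloisRestrict K (v.adicCompletion K) τ • x ∈ Λ₁) ∧
      (∀ (τ : absoluteGaloisGroup (v.adicCompletion K)), ∀ x ∈ Λ₂,
        absGaloisRestrict K (v.adicCompletion K) τ • x ∈ Λ₂) ∧
      (∀ τ ∈ absInertia (v.adicCompletion K), ∀ x ∈ geomTorsion W p,
        absGaloisRestrict K (v.adicCompletion K) τ • x - x ∈ Λ₁) ∧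
      (∀ τ ∈ absInertia (v.adicCompletion K), ∀ x ∈ geomTorsion W ((p ^ 2 : ℕ) : ℤ),
        absGaloisRestrict K (v.adicCompletion K) τ • x - x ∈ Λ₂) := by
  obtain ⟨w, hw, φ, Φ₀, hX, _, hΔO, hΦ₀⟩ := exists_goodReduction_localModel W v hgood
  set f : geomPoints W →+ (((W.localMinimalIntegralModel v).map φ).map
      (IsLocalRing.residue w.valuationSubring)).toAffine.Point :=
    (goodReductionHom ((W.localMinimalIntegralModel v).map φ)
      (Valuation.valuationSubring.integers w) hΔO).comp
      (((Φ₀.trans (Affine.Point.congrEquiv hX)).toAddMonoidHom).comp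
        (pointsMap W (v.adicCompletion K))) with hfdef
  obtain ⟨hstab, hinv, hcard⟩ := goodReduction_reduction_line W p v hpv hgood hord hw hΔO hX Φ₀ hΦ₀
    f (fun a ↦ rfl)
  obtain ⟨hcard2, x₀, hx₀, hx₀ord, hx₀gen⟩ :=
    natCard_ker_inf_geomTorsion_pow W p v hpv hgood hord hw hΔO hX Φ₀ f (fun a ↦ rfl) 2
  -- stability of `ker f ⊓ E[n]` and the inertia clause, for any `n`
  have hst : ∀ (n : ℤ) (τ : absoluteGaloisGroup (v.adicCompletion K)), ∀ x ∈ f.ker ⊓ geomTorsion W n,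
      absGaloisRestrict K (v.adicCompletion K) τ • x ∈ f.ker ⊓ geomTorsion W n := by
    intro n τ x hx
    obtain ⟨hx1, hx2⟩ := AddSubgroup.mem_inf.mp hx
    refine AddSubgroup.mem_inf.mpr ⟨?_, ?_⟩
    · rw [AddMonoidHom.mem_ker] at hx1 ⊢
      exact hstab τ x hx1
    · rw [mem_torsionBy_iff] at hx2 ⊢
      rw [smul_comm n, hx2, smul_zero]
  have hin : ∀ (n : ℤ), ∀ τ ∈ absInertia (v.adicCompletion K), ∀ x ∈ geomTorsion W n,
      absGaloisRestrict K (v.adicCompletion K) τ • x - x ∈ f.ker ⊓ geomTorsion W n := by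
    intro n τ hτ x hx
    refine AddSubgroup.mem_inf.mpr ⟨?_, ?_⟩
    · rw [AddMonoidHom.mem_ker, map_sub, hinv τ hτ, sub_self]
    · rw [mem_torsionBy_iff] at hx ⊢
      rw [smul_sub, smul_comm n, hx, smul_zero, sub_self]
  refine ⟨f.ker ⊓ geomTorsion W p, f.ker ⊓ geomTorsion W ((p ^ 2 : ℕ) : ℤ), inf_le_right, hcard,
    inf_le_right, hcard2, ?_, ⟨x₀, hx₀, hx₀ord, hx₀gen⟩, hst _, hst _, hin _, hin _⟩
  -- `Λ₂ ⊓ E[p] = Λ₁`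
  have hle : geomTorsion W (p : ℤ) ≤ geomTorsion W ((p ^ 2 : ℕ) : ℤ) := by
    intro x hx
    rw [mem_torsionBy_iff] at hx ⊢
    rw [Nat.cast_pow, pow_two, mul_smul, hx, smul_zero]
  rw [inf_assoc, inf_eq_right.mpr hle]

end Summit.BirchSwinnertonDyer.BirchSwinnertonDyer.Theorems.FullDescentOrdinary
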